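import Literature.Analysis.PDE.ABPContactSet
import Mathlib.MeasureTheory.Function.Jacobian
import HarnessLib

/-!
# The normal mapping inequality (Gilbarg–Trudinger, Lemma 9.2, measure half)

For a bounded open `Ω` in a finite-dimensional real inner product space, `u` continuous on `Ω̄`,
`C¹` on `Ω` with `∇u` differentiable on `Ω`, `u ≤ 0` on `∂Ω` and `x₀ ∈ Ω`:
`μ(B(0, u(x₀)/diam Ω̄)) ≤ ∫_{Γ⁺} |det D(∇u)| dμ` for every additive Haar measure `μ`
(`addHaar_ball_le_lintegral_det_upperContactSet`) — Gilbarg–Trudinger's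
`sup u ≤ (d/ω_n^{1/n}) (∫_{Γ⁺}|det D²u|)^{1/n}` ((9.4) with `g ≡ 1`). Ingredients: the ball is
covered by `∇u(Γ⁺)` (`ball_subset_gradient_image_upperContactSet`), `Γ⁺` is measurable
(`measurableSet_upperContactSet`: by continuity it suffices to test the contact inequality on a
countable dense subset of `Ω`), and Mathlib's Jacobian inequality
`MeasureTheory.addHaar_image_le_lintegral_abs_det_fderiv`.

## References

* D. Gilbarg, N. S. Trudinger, *Elliptic Partial Differential Equations of Second Order* (2001),
  §9.1, Lemma 9.2, (9.4)–(9.6). [GilbargTrudinger2001]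
-/

noncomputable section

open Set Metric MeasureTheory TopologicalSpace Filter RealInnerProductSpace
open scoped Topology ENNReal

namespace Literature.Analysis.PDE.ABP

variable {E : Type*} [NormedAddCommGroup E] [InnerProductSpace ℝ E] [CompleteSpace E]

omit [CompleteSpace E] in
/-- **The contact inequality need only be tested on a dense subset**: if `u` is continuous on the
open set `Ω`, `D ⊆ Ω` with `Ω ⊆ closure D`, and `u x ≤ u y + ⟪p, x − y⟫` for all `x ∈ D`, then
it holds for all `x ∈ Ω`. [folklore] -/
theorem contact_of_dense {Ω D : Set E} {u : E → ℝ} (hu : ContinuousOn u Ω)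
    (hD : D ⊆ Ω) (hdense : Ω ⊆ closure D) {y p : E} (h : ∀ x ∈ D, u x ≤ u y + ⟪p, x - y⟫)
    {x : E} (hx : x ∈ Ω) : u x ≤ u y + ⟪p, x - y⟫ := by
  -- `g z = u y + ⟪p, z − y⟫ − u z` is continuous on `Ω`, `≥ 0` on `D`, hence at `x ∈ closure D`
  have hg : ContinuousOn (fun z ↦ u y + ⟪p, z - y⟫ - u z) Ω :=
    (continuousOn_const.add ((continuous_const.inner (continuous_id.sub continuous_const)).continuousOn)).sub hu
  have hxD : x ∈ closure D := hdense hx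
  have hne : (𝓝[D] x).NeBot := mem_closure_iff_nhdsWithin_neBot.1 hxD
  have htend : Tendsto (fun z ↦ u y + ⟪p, z - y⟫ - u z) (𝓝[D] x) (𝓝 (u y + ⟪p, x - y⟫ - u x)) :=
    ((hg x hx).mono hD).tendsto
  have hev : ∀ᶠ z in 𝓝[D] x, 0 ≤ u y + ⟪p, z - y⟫ - u z :=
    eventually_nhdsWithin_of_forall fun z hz ↦ by linarith [h z hz]
  have := ge_of_tendsto htend hev
  linarith

/-- **The upper contact set is measurable** (for `u`, `∇u` continuous on the open `Ω`): it is
`Ω ∩ ⋂_{x ∈ D} {y ∈ Ω | u x ≤ u y + ⟪∇u y, x − y⟫}` for a countable dense `D ⊆ Ω`, each set being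
`Ω` minus a relatively open set. [cite: GilbargTrudinger2001, §9.1] -/
theorem measurableSet_upperContactSet [SecondCountableTopology E] [MeasurableSpace E]
    [BorelSpace E] {Ω : Set E} (hΩo : IsOpen Ω) {u : E → ℝ} (hu : ContinuousOn u Ω)
    (hgu : ContinuousOn (gradient u) Ω) : MeasurableSet (upperContactSet u Ω) := by
  obtain ⟨D, hDΩ, hDc, hdense⟩ := (IsSeparable.of_separableSpace Ω).exists_countable_dense_subset
  set A : E → Set E := fun x ↦ {y ∈ Ω | u x ≤ u y + ⟪gradient u y, x - y⟫} with hA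
  have hrepr : upperContactSet u Ω = Ω ∩ ⋂ x ∈ D, A x := by
    ext y
    simp only [mem_upperContactSet, mem_inter_iff, mem_iInter, hA, mem_setOf_eq]
    constructor
    · rintro ⟨hy, h⟩
      exact ⟨hy, fun x hx ↦ ⟨hy, h x (hDΩ hx)⟩⟩
    · rintro ⟨hy, h⟩
      exact ⟨hy, fun x hx ↦ contact_of_dense hu hDΩ hdense (fun x' hx' ↦ (h x' hx').2) hx⟩
  have hAm : ∀ x, MeasurableSet (A x) := fun x ↦ by
    have hF : ContinuousOn (fun y ↦ u y + ⟪gradient u y, x - y⟫) Ω :=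
      hu.add (hgu.inner (continuousOn_const.sub continuousOn_id))
    have hopen : IsOpen (Ω ∩ (fun y ↦ u y + ⟪gradient u y, x - y⟫) ⁻¹' Iio (u x)) :=
      hF.isOpen_inter_preimage hΩo isOpen_Iio
    have hAx : A x = Ω \ (Ω ∩ (fun y ↦ u y + ⟪gradient u y, x - y⟫) ⁻¹' Iio (u x)) := by
      ext y
      constructor
      · rintro ⟨hy, h⟩
        refine ⟨hy, fun hy' ↦ ?_⟩
        have h' : u y + ⟪gradient u y, x - y⟫ < u x := hy'.2
        exact absurd h (not_le.2 h')
      · rintro ⟨hy, h⟩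
        refine ⟨hy, le_of_not_gt fun h' ↦ h ⟨hy, ?_⟩⟩
        exact h'
    rw [hAx]
    exact hΩo.measurableSet.diff hopen.measurableSet
  rw [hrepr]
  exact hΩo.measurableSet.inter (MeasurableSet.biInter hDc fun x _ ↦ hAm x)

/-- **The normal mapping inequality** (Gilbarg–Trudinger, Lemma 9.2): for a bounded open `Ω`,
`u` continuous on `Ω̄`, differentiable on `Ω` with `∇u` continuous and differentiable on `Ω`,
`u ≤ 0` on `∂Ω`, `x₀ ∈ Ω` and `diam Ω̄ > 0`,
`μ(B(0, u(x₀)/diam Ω̄)) ≤ ∫_{Γ⁺} |det D(∇u)(y)| dμ(y)` for every additive Haar measure `μ`.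
With `μ(B(0,r)) = ω_n rⁿ` this is `sup u ≤ (d/ω_n^{1/n})(∫_{Γ⁺}|det D²u|)^{1/n}`, (9.4)–(9.6).
[cite: GilbargTrudinger2001, §9.1, Lemma 9.2] -/
theorem addHaar_ball_le_lintegral_det_upperContactSet [FiniteDimensional ℝ E]
    [MeasurableSpace E] [BorelSpace E] (μ : Measure E) [μ.IsAddHaarMeasure] {Ω : Set E}
    (hΩo : IsOpen Ω) (hΩb : Bornology.IsBounded Ω) {u : E → ℝ}
    (hu : ContinuousOn u (closure Ω)) (hdiff : ∀ y ∈ Ω, DifferentiableAt ℝ u y)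
    (hgu : ContinuousOn (gradient u) Ω) (hD2 : ∀ y ∈ Ω, DifferentiableAt ℝ (gradient u) y)
    (hbd : ∀ y ∈ frontier Ω, u y ≤ 0) {x₀ : E} (hx₀ : x₀ ∈ Ω) (hd : 0 < diam (closure Ω)) :
    μ (ball (0 : E) (u x₀ / diam (closure Ω))) ≤
      ∫⁻ y in upperContactSet u Ω, ENNReal.ofReal |(fderiv ℝ (gradient u) y).det| ∂μ := by
  haveI : ProperSpace E := FiniteDimensional.proper ℝ E
  have hcover := ball_subset_gradient_image_upperContactSet hΩo hΩb hu hdiff hbd hx₀ hd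
  have hmeas : MeasurableSet (upperContactSet u Ω) :=
    measurableSet_upperContactSet hΩo (hu.mono subset_closure) hgu
  have hderiv : ∀ y ∈ upperContactSet u Ω,
      HasFDerivWithinAt (gradient u) (fderiv ℝ (gradient u) y) (upperContactSet u Ω) y :=
    fun y hy ↦ (hD2 y hy.1).hasFDerivAt.hasFDerivWithinAt
  exact (measure_mono hcover).trans (addHaar_image_le_lintegral_abs_det_fderiv μ hmeas hderiv)

end Literature.Analysis.PDE.ABP

end
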